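import Summits.HodgeConjecture.HodgeConjecture.Theorems.ThreefoldSquareAllDegrees
import Summits.HodgeConjecture.HodgeConjecture.Theorems.ThreefoldConiveauOneOddPieces
import Summits.HodgeConjecture.HodgeConjecture.Theorems.UniruledThreefoldInputs
import Summits.HodgeConjecture.HodgeConjecture.Theorems.ThreefoldTimesCurveHodge
import Literature.AlgebraicGeometry.HodgeTheory.SmoothHyperplaneSectionPolarization
import HarnessLib

/-!
# The Hodge conjecture for the whole square of a UNIRULED threefold, granted `E(S)` of one polarising surface section
# (cell `hodge-nonav`, sector SQ3 — the uniruled LEAF of the master square)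

PROVENANCE. Cell hodge-nonav (HUMAN RULING D-0038), planner p1 g35 (STATUS 2026-08-28T07:24:20Z ruling A1, 07:50:42Z assignment
«uniruled leaf»), prover seat `hodge-nonav-20241-p1` (g11). SUPPORT FILE (`--supports stmt-HodgeConjecture-19654 --as helper`). By the
planner's ruling this leaf is the ONE file of the sector allowed to sit in the import cone of `Theses/SecondaryPeriods` (through
`Theorems/ThreefoldTimesCurveHodge`, whose `hc22TimesCurve_of_hasChowZeroSupportedInDimLE_two` supplies `HC22C[X]`); the cone-free
master `Theorems/ThreefoldSquareAllDegrees` (seat 19716-p2) is untouched and consumed BY NAME.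

CONTENT (closed forms; every input a tree theorem or a DISPLAYED published fact):
* (L1) `hodgeConjectureFor_sq_of_not_isOfGeneralType_of_hasChowZeroSupportedInDimLE_two`: `κ(X) < 3` and `CH₀(X)` supported on a surface
  ⟹ `HC(X × X)` in every codimension, granted `E(S)` of one polarising surface `i : S ⟶ X` — the master's
  `hodgeConjectureFor_sq_of_B_surface_bertini_of_hasChowZeroSupportedInDimLE_two` with `B⋆(X)` from Tankeev's named fact and `HC22C[X]`
  from `CH₀(X) ≤ 2` alone (`ThreefoldTimesCurve.hc22TimesCurve_of_hasChowZeroSupportedInDimLE_two`: Bloch–Srinivas `N¹H³ = H³` + the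
  level-one-coniveau converse; `HC22TimesCurve X` is `HC22C[X]` symbol for symbol) — so the master's binder `hWC` (`CH₀` of the FOURFOLDS
  `X × C`) is gone;
* (L2) **`hodgeConjectureFor_sq_of_isUniruled`: the Hodge conjecture for the WHOLE square `X × X` of every UNIRULED smooth projective
  complex threefold, granted `E(S)` for one polarising surface section**, modulo the four displayed published facts {Tankeev 2011,
  Debarre 2001 Cor. 4.12 (plurigenera), Debarre 2001 Rem. 4.2 (4) (rational curves through every point), Hartshorne–Bertini}: a uniruled
  threefold is not of general type (`not_isOfGeneralType_of_isUniruled`) and has `CH₀` on a surface (`hasChowZeroSupportedInDimLE_two_of_isUniruled`);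
* (L2″) `hodgeConjectureFor_sq_of_isUniruled_of_forall_section`: the same with the surface produced by Bertini
  (`exists_smoothSurfaceSection_isPolarizationClass`) and `E(·)` asked of EVERY polarising surface section;
* (L3) `…_of_algebraicClasses_one_eq_top`: the `p_g(S) = 0` form — `E(S)` discharged when `H²(S) = N¹H²(S)`
  (`weightTwoEnd_algebraic_of_algebraicClasses_one_eq_top`).

HONEST SCOPE. Conditional structure theorems: the Hodge-theoretic input `E(S)` ("every rational Hodge endomorphism of `H²(S)` is
algebraic", open when `p_g(S) > 0`) stays displayed; the four named facts are genuine published theorems consumed through binders. Nothing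
here proves the Hodge conjecture for a new variety unconditionally; rung F-H1 not moved.

## References

* [Tankeev2011] S. G. Tankeev, On the standard conjecture of Lefschetz type for complex projective threefolds. II, Izv. Math. 75 (2011).
* [Debarre2001] O. Debarre, Higher-Dimensional Algebraic Geometry (2001), Remarks 4.2 (4), Lemma 3.7, Cor. 4.12.
* [BlochSrinivas1983] S. Bloch, V. Srinivas, Remarks on correspondences and algebraic cycles (1983), Thm. 1.
* [Hartshorne1977] R. Hartshorne, Algebraic Geometry (1977), II Thm. 8.18, III Cor. 7.9.
* [VoisinHodgeII2003] C. Voisin, Hodge Theory and Complex Algebraic Geometry II (2003), Thm. 10.17, Prop. 10.26, §10.2.3.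
-/

set_option linter.dupNamespace false

noncomputable section

open CategoryTheory AlgebraicGeometry MonoidalCategory CartesianMonoidalCategory
open Literature.AlgebraicTopology.SingularHomology
open Literature.AlgebraicGeometry Literature.AlgebraicGeometry.Motives Literature.AlgebraicGeometry.HodgeTheory
open Literature.Barriers.HodgeConjecture
open Literature.AlgebraicGeometry.Tankeev2011
open Summit.HodgeConjecture.HodgeConjecture.Theorems
open Summit.HodgeConjecture.HodgeConjecture.Theorems.ThreefoldTimesCurve

namespace Summit.HodgeConjecture.HodgeConjecture.Theorems.ThreefoldSquare

/-- `RHShift[m, n, Y, X, a, b, e, φ]` (as in `Theorems/ThreefoldSquareKunnethShifts`). Local notation only. -/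
local notation3 (prettyPrint := false) "RHShift[" m ", " n ", " Y ", " X ", " a ", " b ", " e ", " φ "]" =>
  ((∀ c, IsRationalClass c → IsRationalClass (φ c)) ∧
  (∀ (p q : ℕ), p + q = a → ∀ c, IsOfHodgeType n X a p q c →
      ∀ (p' q' : ℕ), p' + n = p + e → q' + n = q + e → IsOfHodgeType m Y b p' q' (φ c)) ∧
  (∀ (p q : ℕ), p + q = a → ∀ c, IsOfHodgeType n X a p q c → (p + e < n ∨ q + e < n) → φ c = 0))

/-- `ES[S]` (as in `Theorems/ThreefoldSquareWeightTwoDescent`): every rational Hodge endomorphism of `H²(S)` is algebraic. Local notation only. -/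
local notation3 (prettyPrint := false) "ES[" S "]" =>
  (∀ ψ : complexBetti S (2 * 1) →ₗ[ℂ] complexBetti S (2 * 1),
    RHShift[2, 2, S, S, 2 * 1, 2 * 1, 2, ψ] → IsAlgebraicCorrespondence 2 2 S S ψ)

/-- `SecCl[hS, hX, i]` (as in `Theorems/ThreefoldSquareWeightTwoDescent`): the class `i_* 1_S ∈ H²(X)`. Local notation only. -/
local notation3 (prettyPrint := false) "SecCl[" hS ", " hX ", " i "]" =>
  complexGysin complexOrientationFamily hS hX i (rfl : 0 + 2 * 3 = 2 + 2 * 2)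
    (singularCohomology.one ℂ (ComplexPoints _))

variable {X S : SchemeOver ℂ}

/-! ## §1 Off general type with `CH₀` on a surface -/

/-- **(L1) `κ(X) < 3` and `CH₀(X)` supported on a surface ⟹ `HC(X × X)` in every codimension, granted `E(S)` of one polarising surface
`i : S ⟶ X`** — the master `hodgeConjectureFor_sq_of_B_surface_bertini_of_hasChowZeroSupportedInDimLE_two` with `B⋆(X)` from Tankeev's
named fact and `HC22C[X]` from `CH₀(X) ≤ 2` on `X` ALONE (`ThreefoldTimesCurve.hc22TimesCurve_of_hasChowZeroSupportedInDimLE_two`).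
CONDITIONAL on the displayed facts (Tankeev 2011, Hartshorne–Bertini). [cite: Tankeev2011, main theorem]
[cite: BlochSrinivas1983, Thm. 1 (2)–(3)] [cite: VoisinHodgeII2003, Thm. 10.17 and §10.2.3] [cite: Hartshorne1977, II Thm. 8.18 and III Cor. 7.9] -/
theorem hodgeConjectureFor_sq_of_not_isOfGeneralType_of_hasChowZeroSupportedInDimLE_two
    (hT : Tankeev2011_lefschetzStandard_threefold_kodairaDim_lt_three) (hBert : Hartshorne1977_bertini_smoothHyperplaneSections)
    (hX : IsSmoothProjective 3 X) (hκ : ¬ IsOfGeneralType 3 X) (hW : HasChowZeroSupportedInDimLE X 2)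
    (hS : IsSmoothProjective 2 S) (i : S ⟶ X) (hσ : IsPolarizationClass 3 X (SecCl[hS, hX, i])) (hE : ES[S]) :
    HodgeConjectureFor 6 (X ⊗ X) :=
  hodgeConjectureFor_sq_of_B_surface_bertini_of_hasChowZeroSupportedInDimLE_two hBert hX hW hS i hσ (hT hX hκ) hE
    (hc22TimesCurve_of_hasChowZeroSupportedInDimLE_two hX hW)

/-! ## §2 Uniruled threefolds -/

/-- **(L2) The Hodge conjecture for the WHOLE square `X × X`, in every codimension, of every UNIRULED smooth projective complex threefold,
granted `E(S)` for one polarising surface `i : S ⟶ X`**, modulo the four displayed published facts: Tankeev 2011 (`B(X)` for `κ(X) < 3`),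
Debarre 2001 Cor. 4.12 (uniruled ⟹ plurigenera vanish ⟹ not of general type), Debarre 2001 Remarks 4.2 (4) (rational curves through every
point ⟹ `CH₀(X)` on a surface), Hartshorne II 8.18 / III 7.9 (Bertini). (statement: cell hodge-nonav uniruled row; assembly not in print)
[cite: Tankeev2011, main theorem] [cite: Debarre2001, Cor. 4.12 and Remarks 4.2 (4)] [cite: BlochSrinivas1983, Thm. 1]
[cite: Hartshorne1977, II Thm. 8.18 and III Cor. 7.9] -/
theorem hodgeConjectureFor_sq_of_isUniruled
    (hT : Tankeev2011_lefschetzStandard_threefold_kodairaDim_lt_three) (hDP : Debarre2001_uniruled_plurigenera_eq_zero)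
    (hDeb : Debarre2001_uniruled_rationalCurve_through_every_point) (hBert : Hartshorne1977_bertini_smoothHyperplaneSections)
    (hX : IsSmoothProjective 3 X) (hU : IsUniruled X)
    (hS : IsSmoothProjective 2 S) (i : S ⟶ X) (hσ : IsPolarizationClass 3 X (SecCl[hS, hX, i])) (hE : ES[S]) :
    HodgeConjectureFor 6 (X ⊗ X) :=
  hodgeConjectureFor_sq_of_not_isOfGeneralType_of_hasChowZeroSupportedInDimLE_two hT hBert hX
    (not_isOfGeneralType_of_isUniruled hDP hX hU) (hasChowZeroSupportedInDimLE_two_of_isUniruled hDeb hX hU) hS i hσ hE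

/-- **(L2″) Section-free form**: for a uniruled threefold, `HC(X × X)` in every codimension as soon as `E(S)` holds for EVERY smooth
projective surface `S` with a morphism `i : S ⟶ X` whose class `i_* 1_S` is polarising (one such `S` exists by Bertini,
`exists_smoothSurfaceSection_isPolarizationClass`). [cite: Hartshorne1977, II Thm. 8.18 and III Cor. 7.9] [cite: Tankeev2011, main theorem]
[cite: Debarre2001, Cor. 4.12 and Remarks 4.2 (4)] -/
theorem hodgeConjectureFor_sq_of_isUniruled_of_forall_section
    (hT : Tankeev2011_lefschetzStandard_threefold_kodairaDim_lt_three) (hDP : Debarre2001_uniruled_plurigenera_eq_zero)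
    (hDeb : Debarre2001_uniruled_rationalCurve_through_every_point) (hBert : Hartshorne1977_bertini_smoothHyperplaneSections)
    (hX : IsSmoothProjective 3 X) (hU : IsUniruled X)
    (hE : ∀ ⦃S : SchemeOver ℂ⦄ (hS : IsSmoothProjective 2 S) (i : S ⟶ X), IsPolarizationClass 3 X (SecCl[hS, hX, i]) → ES[S]) :
    HodgeConjectureFor 6 (X ⊗ X) := by
  obtain ⟨S, hS, i, hσ⟩ := exists_smoothSurfaceSection_isPolarizationClass hBert hX
  exact hodgeConjectureFor_sq_of_isUniruled hT hDP hDeb hBert hX hU hS i hσ (hE hS i hσ)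

/-! ## §3 The `p_g(S) = 0` form -/

/-- **(L3) `E(S)` discharged when `H²(S) = N¹H²(S)`** (e.g. `p_g(S) = 0`, by Lefschetz `(1,1)`): a uniruled threefold with a polarising
surface `i : S ⟶ X` all of whose degree-2 classes are divisor classes satisfies `HC(X × X)` in every codimension
(`weightTwoEnd_algebraic_of_algebraicClasses_one_eq_top`). [cite: VoisinHodgeI2002, Thm. 11.30 and §11.3.3 Lemma 11.41]
[cite: Tankeev2011, main theorem] [cite: Debarre2001, Cor. 4.12 and Remarks 4.2 (4)] -/
theorem hodgeConjectureFor_sq_of_isUniruled_of_algebraicClasses_one_eq_top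
    (hT : Tankeev2011_lefschetzStandard_threefold_kodairaDim_lt_three) (hDP : Debarre2001_uniruled_plurigenera_eq_zero)
    (hDeb : Debarre2001_uniruled_rationalCurve_through_every_point) (hBert : Hartshorne1977_bertini_smoothHyperplaneSections)
    (hX : IsSmoothProjective 3 X) (hU : IsUniruled X)
    (hS : IsSmoothProjective 2 S) (i : S ⟶ X) (hσ : IsPolarizationClass 3 X (SecCl[hS, hX, i]))
    (h₂ : algebraicClasses S 1 = ⊤) : HodgeConjectureFor 6 (X ⊗ X) :=
  hodgeConjectureFor_sq_of_isUniruled hT hDP hDeb hBert hX hU hS i hσ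
    (weightTwoEnd_algebraic_of_algebraicClasses_one_eq_top hS h₂)

/-- **(L1′) the same `p_g(S) = 0` form off general type with `CH₀(X)` on a surface.** [cite: Tankeev2011, main theorem]
[cite: BlochSrinivas1983, Thm. 1] [cite: VoisinHodgeI2002, Thm. 11.30] -/
theorem hodgeConjectureFor_sq_of_not_isOfGeneralType_of_hasChowZeroSupportedInDimLE_two_of_algebraicClasses_one_eq_top
    (hT : Tankeev2011_lefschetzStandard_threefold_kodairaDim_lt_three) (hBert : Hartshorne1977_bertini_smoothHyperplaneSections)
    (hX : IsSmoothProjective 3 X) (hκ : ¬ IsOfGeneralType 3 X) (hW : HasChowZeroSupportedInDimLE X 2)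
    (hS : IsSmoothProjective 2 S) (i : S ⟶ X) (hσ : IsPolarizationClass 3 X (SecCl[hS, hX, i]))
    (h₂ : algebraicClasses S 1 = ⊤) : HodgeConjectureFor 6 (X ⊗ X) :=
  hodgeConjectureFor_sq_of_not_isOfGeneralType_of_hasChowZeroSupportedInDimLE_two hT hBert hX hκ hW hS i hσ
    (weightTwoEnd_algebraic_of_algebraicClasses_one_eq_top hS h₂)

/-! ## Appended 2026-08-28 (same seat, g11): (L2′) the BERTINI-FREE uniruled square, on the coniveau-one master

After `Theorems/ThreefoldConiveauOneOddPieces` (seat 19716-p2, p614259): on the locus `N¹H³(X) = H³(X)` — implied by `CH₀(X)` on a surface —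
the odd Künneth pieces need no curve input, so the uniruled square loses both the Hartshorne–Bertini binder and the `HC22C[X]` input:
`hodgeConjectureFor_sq_of_tankeev_surface_of_hasChowZeroSupportedInDimLE_two` + the two uniruled inputs of `Theorems/UniruledThreefoldInputs`.
These corollaries use NO declaration of the `SecondaryPeriods` cone (they would compile verbatim in a cone-free file). -/

/-- **(L2′) The Hodge conjecture for the WHOLE square of every UNIRULED smooth projective complex threefold, granted `E(S)` of one polarising
surface `i : S ⟶ X` — modulo THREE displayed published facts** {Tankeev 2011, Debarre 2001 Cor. 4.12, Debarre 2001 Remarks 4.2 (4)}; no Bertini,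
no curve input, no `E₃`. (statement: cell hodge-nonav uniruled row, final form; assembly not in print) [cite: Tankeev2011, main theorem]
[cite: Debarre2001, Cor. 4.12 and Remarks 4.2 (4)] [cite: BlochSrinivas1983, Thm. 1] [cite: Voisin2013GHCBloch, Lemma 2.1] -/
theorem hodgeConjectureFor_sq_of_isUniruled'
    (hT : Tankeev2011_lefschetzStandard_threefold_kodairaDim_lt_three) (hDP : Debarre2001_uniruled_plurigenera_eq_zero)
    (hDeb : Debarre2001_uniruled_rationalCurve_through_every_point) (hX : IsSmoothProjective 3 X) (hU : IsUniruled X)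
    (hS : IsSmoothProjective 2 S) (i : S ⟶ X) (hσ : IsPolarizationClass 3 X (SecCl[hS, hX, i])) (hE : ES[S]) :
    HodgeConjectureFor 6 (X ⊗ X) :=
  hodgeConjectureFor_sq_of_tankeev_surface_of_hasChowZeroSupportedInDimLE_two hT hX (not_isOfGeneralType_of_isUniruled hDP hX hU)
    (hasChowZeroSupportedInDimLE_two_of_isUniruled hDeb hX hU) hS i hσ hE

/-- **(L2′, `p_g(S) = 0` form)**: `E(S)` discharged when `H²(S) = N¹H²(S)`; three displayed facts. [cite: Tankeev2011, main theorem]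
[cite: Debarre2001, Cor. 4.12 and Remarks 4.2 (4)] [cite: VoisinHodgeI2002, Thm. 11.30] -/
theorem hodgeConjectureFor_sq_of_isUniruled_of_algebraicClasses_one_eq_top'
    (hT : Tankeev2011_lefschetzStandard_threefold_kodairaDim_lt_three) (hDP : Debarre2001_uniruled_plurigenera_eq_zero)
    (hDeb : Debarre2001_uniruled_rationalCurve_through_every_point) (hX : IsSmoothProjective 3 X) (hU : IsUniruled X)
    (hS : IsSmoothProjective 2 S) (i : S ⟶ X) (hσ : IsPolarizationClass 3 X (SecCl[hS, hX, i]))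
    (h₂ : algebraicClasses S 1 = ⊤) : HodgeConjectureFor 6 (X ⊗ X) :=
  hodgeConjectureFor_sq_of_isUniruled' hT hDP hDeb hX hU hS i hσ (weightTwoEnd_algebraic_of_algebraicClasses_one_eq_top hS h₂)

/-- **(L2″′) Section-free, Bertini only for the EXISTENCE of the surface**: a uniruled threefold satisfies `HC(X × X)` in every codimension
as soon as `E(S)` holds for every polarising surface section (four displayed facts, the fourth — Hartshorne–Bertini — used only to produce `S`).
[cite: Hartshorne1977, II Thm. 8.18 and III Cor. 7.9] [cite: Tankeev2011, main theorem] [cite: Debarre2001, Cor. 4.12 and Remarks 4.2 (4)] -/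
theorem hodgeConjectureFor_sq_of_isUniruled_of_forall_section'
    (hT : Tankeev2011_lefschetzStandard_threefold_kodairaDim_lt_three) (hDP : Debarre2001_uniruled_plurigenera_eq_zero)
    (hDeb : Debarre2001_uniruled_rationalCurve_through_every_point) (hBert : Hartshorne1977_bertini_smoothHyperplaneSections)
    (hX : IsSmoothProjective 3 X) (hU : IsUniruled X)
    (hE : ∀ ⦃S : SchemeOver ℂ⦄ (hS : IsSmoothProjective 2 S) (i : S ⟶ X), IsPolarizationClass 3 X (SecCl[hS, hX, i]) → ES[S]) :
    HodgeConjectureFor 6 (X ⊗ X) := by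
  obtain ⟨S, hS, i, hσ⟩ := exists_smoothSurfaceSection_isPolarizationClass hBert hX
  exact hodgeConjectureFor_sq_of_isUniruled' hT hDP hDeb hX hU hS i hσ (hE hS i hσ)

end Summit.HodgeConjecture.HodgeConjecture.Theorems.ThreefoldSquare

end
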